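import Summits.BirchSwinnertonDyer.BirchSwinnertonDyer.Theorems.GenusKolyvaginAtTwoGenusPrimitiveSupplyAtTwoArchimedeanDescAdmissible
import Summits.BirchSwinnertonDyer.BirchSwinnertonDyer.Theorems.GenusKolyvaginAtTwoGenusPrimitiveSupplyAtTwoArchimedeanRelaxedSwitchEgg
import Literature.NumberTheory.EllipticCurves.PrimeTwistLocalConditionSplitPlace
import Literature.NumberTheory.EllipticCurves.PrimeTwistLocalConditionNoTorsion
import Literature.NumberTheory.EllipticCurves.MordellWeilTheoremProofs
import HarnessLib

/-!
# Route `GenusKolyvaginAtTwo`, crux #2 `GenusPrimitiveSupplyAtTwo` (stmt-BirchSwinnertonDyer-22136):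
# the PRIME-TWIST DICTIONARY over `ℚ` at the descent-admissible places, and DESC-§17-R `F1Sign2.TwistSelmerEqRelaxedAtInfinityAtTwo`
# MODULO ONE displayed local comparison (the good primes INERT in `ℚ(√d)`)

Width seat `bsd-line-gk2-p5` g14 (cell `bsd-f1-sign2`, SUPPLY lineage of crux 22136), file 30 of the series; sequel of files 28/29
(`…ArchimedeanRelaxedSwitch{,Egg}`, the ∞-switch of `Sel₂`) and of the two Literature bricks `PrimeTwistLocalConditionSplitPlace` /
`PrimeTwistLocalConditionNoTorsion` (Mazur–Rubin 2007: `H¹_𝒜(K_v) = H¹_f(K_v)` at a split place / at a place with `E(K_v)[p] = 0`).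
THEOREMS ONLY (no definition, no named fact, no `sorry`); helper `--supports stmt-BirchSwinnertonDyer-22136`; no item is closed; BSD is not
proved by any of this.

WHY. The cell's -desc rows DESC-§17-R `TwistSelmerEqRelaxedAtInfinityAtTwo`, U′ `OddBranchShaIndexTwoInTwistSelmerAtTwo`, B⁰ and the -an lens's
T-2q `iff` BY NAME are phrased with Mazur–Rubin's PRIME-TWIST Selmer group `PrimeTwist.selmerGroup W χ` (`Literature/…/UnramifiedPrimeTwist`,
MR 2007 Def. 4.3) for `χ` the quadratic character of `ℚ(√d)` (`F1Sign2.IsQuadraticCharacterOf χ d`), while every kernel theorem of this lineage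
(Cor. 3.4 (i) UP/DOWN, T-A/T-V/T-C, the ∞-switch) lives in the MODEL currency `W^{(d)}` / `kummerSelmerStructure`. The missing link is local:
`PrimeTwist.selmerLocalKer W χ ℚ_v` versus `W.selmerLocalKer ℚ_v 2` place by place. For a descent-admissible `d` (`F1Sign2.DescAdmissible`:
`d < 0`, `d ≡ 1 (8)`, the primes of `d` good with `a_q` odd, `(d/ℓ) = 1` at the odd bad `ℓ`) this file proves:

* §123 `localChar_eq_one_of_exists_sq` — `χ` is trivial on `Γ_F` for every `ℚ`-field `F` containing a square root of `d` (the chosen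
  `ℚ̄ → F̄` carries `√d` to `±` it; `IsQuadraticCharacterOf`).
* §124 THE DICTIONARY AT THE ADMISSIBLE PLACES: `primeTwist_selmerLocalKer_adicCompletion_eq_of_exists_sq` (a local square root of `d`:
  `v = 2` since `d ≡ 1 (8)`, the odd bad `ℓ`, the good `q` with `(d/q) = 1`) and `primeTwist_selmerLocalKer_adicCompletion_eq_of_natCard_ker_eq_one`
  (odd `v` with `W(ℚ_v)[2] = 0`: the primes of `d`) — both from the Literature bricks.
* §125 `descAdmissible_place_trichotomy` — every finite place of `ℚ` has a local square root of `d`, or is odd with `W(ℚ_v)[2] = 0`, or is an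
  odd GOOD place WITHOUT a local square root of `d` (the primes inert in `ℚ(√d)`; proof = the `W`-half of gk2-p4's `descAdmissible_place_menu`).
* §126 **`primeTwist_selmerGroup_le_relaxed_of_inert`** — DESC-§17-R part 1 `PrimeTwist.selmerGroup W χ ≤ Sel₂^{rel ∞}(W)` GIVEN the inert
  comparison `hinert : ∀ v odd good with no local √d, PrimeTwist.selmerLocalKer W χ ℚ_v ≤ W.selmerLocalKer ℚ_v 2` (Mazur–Rubin 2007 Lemma 5.? /
  2010 Lemma 2.10 (v) in prime-twist currency: `H¹_𝒜 = H¹_f = H¹_ur` at a good prime unramified in `L/K` — NOT in the tree for `A_χ`; the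
  model-currency version IS (this lineage's file 38 `…TwistUnramifiedGoodNorm`, Mazur's norm theorem)), and **`primeTwist_selmerGroup_eq_relaxed_of_inert`**
  — part 2: if moreover `#PrimeTwist.selmerGroup W χ = 2·#Sel₂(W)` then `PrimeTwist.selmerGroup W χ = Sel₂^{rel ∞}(W)` (the ∞-switch bound
  `[Sel₂^{rel ∞} : Sel₂] ≤ 2`, `Sel₂` finite by the tree's weak Mordell–Weil `finite_selmerGroup_holds`).
* §127 **`twistSelmerEqRelaxedAtInfinityAtTwo_of_inertComparison : InertPrimeTwistComparison-shaped hypothesis → F1Sign2.TwistSelmerEqRelaxedAtInfinityAtTwo`**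
  — DESC-§17-R BY NAME modulo that ONE displayed local statement (spelled out in the binder, no definition).

Honest framing: KNOWN in print (Mazur–Rubin 2007 §§4–5, 2010 §§2–3; Kramer 1981); kernel-new bookkeeping; beyond-print theorem: no; the inert
brick is the successor's target. Crux 22136 stays OPEN exactly at (U) 24947 ∧ (CONV₂) 19220/24948. BSD is not proved by any of this.

References: [MazurRubin2007] Def. 4.3, Cor. 4.6, §5; [MazurRubin2010] Def. 3.1, Lemma 3.2, Lemma 2.10; [Kramer1981] Prop. 3, Prop. 6;
[Serre1973] Ch. II §3.3.
-/

set_option linter.dupNamespace false -- tree convention: `Summit.BirchSwinnertonDyer.BirchSwinnertonDyer.Theorems` (summit = sub-problem)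
set_option autoImplicit false

noncomputable section

open scoped Classical ContRepresentation

namespace Summit.BirchSwinnertonDyer.BirchSwinnertonDyer.Theorems.GenusKolyArch

open WeierstrassCurve Field NumberField IsDedekindDomain Function
open Literature.NumberTheory.EllipticCurves Literature.NumberTheory.GaloisRepresentations
open Literature.NumberTheory.GaloisCohomology
open Summit.BirchSwinnertonDyer.BirchSwinnertonDyer.Theorems.GenusKolyTwistLocal
open Summit.BirchSwinnertonDyer.Rank1Residual.F1Sign2
open Rat.HeightOneSpectrum (primesEquiv natGenerator)

/-! ## §123 The quadratic character is locally trivial where `d` is a local square -/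

section LocalChar

variable {χ : absoluteGaloisGroup ℚ →ₜ* Multiplicative (ZMod 2)} {d : ℤ}

/-- **`χ_d` is trivial on `Γ_F` when `d ∈ F^{×2}`** (`F` any `ℚ`-field, e.g. `ℚ_v` or `ℝ`): for `τ ∈ Γ_F`, `resGal τ ∈ Γ_ℚ` acts on a square root
`r ∈ ℚ̄` of `d` through the chosen embedding `ℚ̄ → F̄`, which carries `r` to `± s` (`s² = d` in `F`), fixed by `τ`; and `χ (resGal τ) = 1 ⟺
resGal τ` fixes `r` (`IsQuadraticCharacterOf`). [cite: MazurRubin2007, §5 (the local extensions (L ⊗ K_v)/K_v)] -/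
theorem localChar_eq_one_of_exists_sq (hχ : IsQuadraticCharacterOf χ d) {F : Type} [Field F] [Algebra ℚ F]
    (hs : ∃ s : F, s ^ 2 = algebraMap ℚ F (d : ℚ)) (τ : absoluteGaloisGroup F) : χ (resGal (K := ℚ) F τ) = 1 := by
  obtain ⟨s, hs⟩ := hs
  obtain ⟨r, hr⟩ := IsAlgClosed.exists_pow_nat_eq ((d : ℚ) : AlgebraicClosure ℚ) two_pos
  refine (hχ r hr (resGal (K := ℚ) F τ)).mpr ?_
  -- through the chosen embedding `ι : ℚ̄ → F̄`, `ι r = ± algebraMap s` is fixed by `τ`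
  apply (closureEmb (K := ℚ) F).toRingHom.injective
  have hι : (closureEmb (K := ℚ) F) ((show AlgebraicClosure ℚ ≃ₐ[ℚ] AlgebraicClosure ℚ from resGal (K := ℚ) F τ) r) =
      (show AlgebraicClosure F ≃ₐ[F] AlgebraicClosure F from τ) (closureEmb (K := ℚ) F r) :=
    apply_resGalAuxOfEmb_apply (closureEmb (K := ℚ) F) τ r
  change (closureEmb (K := ℚ) F) ((show AlgebraicClosure ℚ ≃ₐ[ℚ] AlgebraicClosure ℚ from resGal (K := ℚ) F τ) r) =
    closureEmb (K := ℚ) F r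
  rw [hι]
  have hsq : (closureEmb (K := ℚ) F r) ^ 2 = (algebraMap F (AlgebraicClosure F) s) ^ 2 := by
    rw [← map_pow, hr, ← map_pow, hs]
    -- both sides are the image of the integer `d`
    have h1 : (closureEmb (K := ℚ) F) ((d : ℚ) : AlgebraicClosure ℚ) = ((d : ℤ) : AlgebraicClosure F) := by
      simp only [Rat.cast_intCast, map_intCast]
    have h2 : algebraMap F (AlgebraicClosure F) (algebraMap ℚ F (d : ℚ)) = ((d : ℤ) : AlgebraicClosure F) := by
      simp only [map_intCast]
    rw [h1, h2]
  rcases sq_eq_sq_iff_eq_or_eq_neg.mp hsq with h | h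
  · rw [h, AlgEquiv.commutes]
  · rw [h, map_neg, AlgEquiv.commutes]

end LocalChar

/-! ## §124 The prime-twist dictionary at the admissible finite places -/

section Places

variable (W : WeierstrassCurve ℚ) [W.IsElliptic] {χ : absoluteGaloisGroup ℚ →ₜ* Multiplicative (ZMod 2)} {d : ℤ}

omit [W.IsElliptic] in
/-- **A local square root of `d` ⟹ `PrimeTwist.selmerLocalKer W χ ℚ_v = W.selmerLocalKer ℚ_v 2`** (the place splits in `ℚ(√d)`: Literature
`PrimeTwist.selmerLocalKer_eq_of_localChar_eq_one` + §123). For a descent-admissible `d`: `v = 2` (`d ≡ 1 (8)`), the odd bad `ℓ` (`(d/ℓ) = 1`),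
the good `q` with `(d/q) = 1`. [cite: MazurRubin2007, Def 4.3 and §5] -/
theorem primeTwist_selmerLocalKer_adicCompletion_eq_of_exists_sq (hχ : IsQuadraticCharacterOf χ d) (v : HeightOneSpectrum (𝓞 ℚ))
    (hs : ∃ s : v.adicCompletion ℚ, s ^ 2 = algebraMap ℚ (v.adicCompletion ℚ) (d : ℚ)) :
    PrimeTwist.selmerLocalKer W χ (v.adicCompletion ℚ) = W.selmerLocalKer (v.adicCompletion ℚ) 2 :=
  PrimeTwist.selmerLocalKer_eq_of_localChar_eq_one W χ (v.adicCompletion ℚ) (localChar_eq_one_of_exists_sq hχ hs)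

omit [W.IsElliptic] in
/-- The same at the real place: for `d > 0`… not needed on the descent-admissible locus (`d < 0`); recorded for the infinite place `w` of a
`ℚ`-field `F` with `√d ∈ F` in general form. [cite: MazurRubin2007, Def 4.3 and §5] -/
theorem primeTwist_selmerLocalKer_eq_of_exists_sq (hχ : IsQuadraticCharacterOf χ d) (F : Type) [Field F] [Algebra ℚ F]
    (hs : ∃ s : F, s ^ 2 = algebraMap ℚ F (d : ℚ)) :
    PrimeTwist.selmerLocalKer W χ F = W.selmerLocalKer F 2 :=
  PrimeTwist.selmerLocalKer_eq_of_localChar_eq_one W χ F (localChar_eq_one_of_exists_sq hχ hs)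

/-- **No local `2`-torsion at an odd place ⟹ `PrimeTwist.selmerLocalKer W χ ℚ_v = W.selmerLocalKer ℚ_v 2`** (both are everything:
`H¹(ℚ_v, W[2]) = 0`; Literature `PrimeTwist.selmerLocalKer_adicCompletion_eq_of_forall_nsmul_eq_zero`). For a descent-admissible `d`: the primes of `d`
(`a_q` odd). [cite: MazurRubin2007, Def 4.3] [cite: MilneADT2006, Ch. I, Cor. 2.3 and Thm. 2.8] -/
theorem primeTwist_selmerLocalKer_adicCompletion_eq_of_natCard_ker_eq_one (χ : absoluteGaloisGroup ℚ →ₜ* Multiplicative (ZMod 2))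
    (v : HeightOneSpectrum (𝓞 ℚ)) (h2v : ((2 : ℕ) : 𝓞 ℚ) ∉ v.asIdeal)
    (hker : Nat.card (nsmulAddMonoidHom 2 : (W.baseChange (v.adicCompletion ℚ)).toAffine.Point →+ _).ker = 1) :
    PrimeTwist.selmerLocalKer W χ (v.adicCompletion ℚ) = W.selmerLocalKer (v.adicCompletion ℚ) 2 := by
  refine PrimeTwist.selmerLocalKer_adicCompletion_eq_of_forall_nsmul_eq_zero W χ v h2v fun P hP ↦ ?_
  have hmem : P ∈ (nsmulAddMonoidHom 2 : (W.baseChange (v.adicCompletion ℚ)).toAffine.Point →+ _).ker := by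
    rw [AddMonoidHom.mem_ker, nsmulAddMonoidHom_apply]; exact hP
  have h0 : (0 : (W.baseChange (v.adicCompletion ℚ)).toAffine.Point) ∈
      (nsmulAddMonoidHom 2 : (W.baseChange (v.adicCompletion ℚ)).toAffine.Point →+ _).ker := zero_mem _
  haveI := (Nat.card_eq_one_iff_unique.mp hker).1
  exact congrArg Subtype.val (Subsingleton.elim (⟨P, hmem⟩ : (nsmulAddMonoidHom 2 : _ →+ _).ker) ⟨0, h0⟩)

end Places

/-! ## §125 The place trichotomy of a descent-admissible `d` (the `W`-half of `descAdmissible_place_menu`) -/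

section Trichotomy

variable (W : WeierstrassCurve ℚ) [W.IsElliptic] [W.IsGloballyMinimal]

/-- **Every finite place of `ℚ` is split in `ℚ(√d)`, or odd and silent for `W`, or odd, good for `W` and WITHOUT a local square root of `d`**,
for a descent-admissible `d`: over `2`, `d ≡ 1 (8)` is a `2`-adic square; over a prime of `d`, `a_q` odd kills `W(ℚ_q)[2]`; over an odd bad prime
`(d/ℓ) = 1`; the remaining places are odd and good. [cite: Serre1973, Ch. II §3.3 Thm 3, Thm 4] [cite: Kramer1981, Prop. 3] -/
theorem descAdmissible_place_trichotomy {d : ℤ} (hd : DescAdmissible W d) (v : HeightOneSpectrum (𝓞 ℚ)) :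
    (∃ s : v.adicCompletion ℚ, s ^ 2 = algebraMap ℚ (v.adicCompletion ℚ) (d : ℚ)) ∨
      (((2 : ℕ) : 𝓞 ℚ) ∉ v.asIdeal ∧
        Nat.card (nsmulAddMonoidHom 2 : (W.baseChange (v.adicCompletion ℚ)).toAffine.Point →+ _).ker = 1) ∨
      (((2 : ℕ) : 𝓞 ℚ) ∉ v.asIdeal ∧ W.HasGoodReductionAt v ∧
        ∀ s : v.adicCompletion ℚ, s ^ 2 ≠ algebraMap ℚ (v.adicCompletion ℚ) (d : ℚ)) := by
  obtain ⟨-, -, hd8, hprimes, hbad⟩ := hd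
  haveI := Fact.mk (primesEquiv v).2
  have hpP : (primesEquiv v : ℕ).Prime := (primesEquiv v).2
  have hpv : ((primesEquiv v : ℕ) : 𝓞 ℚ) ∈ v.asIdeal := Rat.HeightOneSpectrum.natCast_natGenerator_mem v
  -- a `p`-adic square gives the split option
  have hsplit : IsSquare ((d : ℤ) : ℚ_[(primesEquiv v : ℕ)]) →
      ∃ s : v.adicCompletion ℚ, s ^ 2 = algebraMap ℚ (v.adicCompletion ℚ) (d : ℚ) := fun hsq ↦ by
    have hsq' : IsSquare (((d : ℚ) : ℚ) : ℚ_[(primesEquiv v : ℕ)]) := by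
      simpa only [Rat.cast_intCast] using hsq
    obtain ⟨s, hs⟩ := TwoDescentLocal.isSquare_algebraMap_adicCompletion_of_padic v hsq'
    exact ⟨s, by rw [sq]; exact hs.symm⟩
  by_cases hp2 : (primesEquiv v : ℕ) = 2
  · exact Or.inl (hsplit (Literature.NumberTheory.QuadraticForms.padic_isSquare_intCast_of_mod_eight hp2 hd8))
  have h2v : ((2 : ℕ) : 𝓞 ℚ) ∉ v.asIdeal :=
    GenusKolyTwistingPrime.natCast_not_mem_of_not_dvd hpP hpv fun h ↦
      hp2 ((Nat.prime_dvd_prime_iff_eq hpP Nat.prime_two).mp h)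
  by_cases hpd : ((primesEquiv v : ℕ) : ℤ) ∣ d
  · -- over a prime of `d`: odd, good, `a_p` odd ⟹ silent for `W`
    obtain ⟨hgood, hodd⟩ := hprimes _ hpP hpd
    have hgood' : W.HasGoodReductionAtPrime (primesEquiv v : ℕ) := hgood inferInstance
    have hpΔ : ¬ ((primesEquiv v : ℕ) : ℤ) ∣ minimalDiscriminantInt W :=
      W.not_dvd_minimalDiscriminantInt_of_hasGoodReductionAtPrime' _ hgood'
    have hsil := (GenusKolyTwin.silent_iff_odd_frobeniusTrace W hp2 hpΔ).mpr hodd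
    have hker : Nat.card (nsmulAddMonoidHom 2 : (W.baseChange (v.adicCompletion ℚ)).toAffine.Point →+ _).ker = 1 := by
      rw [natCard_ker_nsmul_adicCompletion_eq_padic W v 2]
      have h0 := GenusKolyTwin.twoTorsion_padic_eq_zero_of_forall_ne W hp2 hpΔ hsil
      rw [Nat.card_eq_one_iff_unique]
      refine ⟨⟨fun a b ↦ Subtype.ext ((h0 a.1 a.2).trans (h0 b.1 b.2).symm)⟩, ⟨⟨0, by simp⟩⟩⟩
    exact Or.inr (Or.inl ⟨h2v, hker⟩)
  by_cases hpN : (primesEquiv v : ℕ) ∣ W.conductorNorm ℤ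
  · -- over an odd bad prime: `(d/p) = 1` makes `d` a `p`-adic square
    have hnotgood : ∀ _h : Fact (primesEquiv v : ℕ).Prime, ¬ W.HasGoodReductionAtPrime (primesEquiv v : ℕ) := fun _ hg ↦
      not_dvd_conductorNorm_of_hasGoodReductionAtPrime W hg hpN
    have hJ := hbad _ hpP hp2 hnotgood
    exact Or.inl (hsplit (padic_isSquare_of_jacobiSym_eq_one hp2 hJ))
  · -- over an odd good prime not dividing `d`: split or inert
    have hW : W.HasGoodReductionAt v := by
      by_contra h
      exact hpN ((W.dvd_conductorNorm_iff v).mpr h)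
    by_cases hsq : ∃ s : v.adicCompletion ℚ, s ^ 2 = algebraMap ℚ (v.adicCompletion ℚ) (d : ℚ)
    · exact Or.inl hsq
    · push Not at hsq
      exact Or.inr (Or.inr ⟨h2v, hW, hsq⟩)

end Trichotomy

/-! ## §126 DESC-§17-R parts 1 and 2 modulo the inert comparison -/

section Relaxed

variable (W : WeierstrassCurve ℚ) [W.IsElliptic] [W.IsGloballyMinimal] {χ : absoluteGaloisGroup ℚ →ₜ* Multiplicative (ZMod 2)} {d : ℤ}

/-- **DESC-§17-R part 1 modulo the inert comparison: `Sel_𝔓(A_χ/ℚ) ≤ Sel₂^{rel ∞}(W)`** — for a descent-admissible `d` with character `χ`, every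
prime-twist Selmer class satisfies `W`'s Kummer condition at every FINITE place: at the split places and the primes of `d` by §124, at the good
primes inert in `ℚ(√d)` by the displayed hypothesis `hinert` (Mazur–Rubin 2010 Lemma 2.10 (v) / 2007 §5 in prime-twist currency — the successor's
brick). [cite: MazurRubin2010, Def. 3.1 and Lemma 2.10] [cite: MazurRubin2007, Def 4.3 and Cor 4.6] -/
theorem primeTwist_selmerGroup_le_relaxed_of_inert (hd : DescAdmissible W d) (hχ : IsQuadraticCharacterOf χ d)
    (hinert : ∀ v : HeightOneSpectrum (𝓞 ℚ), ((2 : ℕ) : 𝓞 ℚ) ∉ v.asIdeal → W.HasGoodReductionAt v →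
      (∀ s : v.adicCompletion ℚ, s ^ 2 ≠ algebraMap ℚ (v.adicCompletion ℚ) (d : ℚ)) →
      PrimeTwist.selmerLocalKer W χ (v.adicCompletion ℚ) ≤ W.selmerLocalKer (v.adicCompletion ℚ) 2) :
    PrimeTwist.selmerGroup W χ ≤ selmerGroupRelaxedAtInfinityAtTwo W := by
  intro c hc
  rw [PrimeTwist.mem_selmerGroup_iff] at hc
  refine (mem_selmerGroupRelaxedAtInfinityAtTwo_iff W c).mpr fun v ↦ ?_
  rcases descAdmissible_place_trichotomy W hd v with hsq | ⟨h2v, hker⟩ | ⟨h2v, hgood, hns⟩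
  · exact (primeTwist_selmerLocalKer_adicCompletion_eq_of_exists_sq W hχ v hsq).le (hc.1 v)
  · exact (primeTwist_selmerLocalKer_adicCompletion_eq_of_natCard_ker_eq_one W χ v h2v hker).le (hc.1 v)
  · exact hinert v h2v hgood hns (hc.1 v)

omit [W.IsGloballyMinimal] in
/-- **`#Sel₂^{rel ∞}(W) ≤ 2·#Sel₂(W)` and `Sel₂^{rel ∞}(W)` is finite** (weak Mordell–Weil `finite_selmerGroup_holds` + the ∞-switch index
`[Sel₂^{rel ∞} : Sel₂] ∈ {1, 2}`, gk2-p4's `selmerIndexInRelaxedAtInfinityAtTwo_holds`). [cite: MazurRubin2010, Lemma 3.2] [cite: SilvermanAEC2009, Thm X.4.2(b)] -/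
theorem natCard_selmerGroupRelaxedAtInfinityAtTwo_le_two_mul :
    Nat.card (selmerGroupRelaxedAtInfinityAtTwo W) ≤ 2 * selmerTwoCard W ∧ Finite (selmerGroupRelaxedAtInfinityAtTwo W) := by
  haveI : Finite (W.selmerGroup ((2 : ℕ) : ℤ)) := W.finite_selmerGroup_holds (by norm_num)
  have hcard := natCard_selmerGroupRelaxedAtInfinityAtTwo_eq_mul W
  have h12 := (GenusKolyTransp.selmerIndexInRelaxedAtInfinityAtTwo_holds W).2
  have hpos : 0 < selmerTwoCard W := by
    change 0 < Nat.card (W.selmerGroup ((2 : ℕ) : ℤ))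
    exact Nat.card_pos
  refine ⟨?_, ?_⟩
  · rcases h12 with h1 | h2
    · rw [hcard, h1]; omega
    · rw [hcard, h2, mul_comm]
  · apply Nat.finite_of_card_ne_zero
    rcases h12 with h1 | h2
    · rw [hcard, h1]; omega
    · rw [hcard, h2]; omega

/-- **DESC-§17-R part 2 modulo the inert comparison: the twist GAINS rank ⟹ `Sel_𝔓(A_χ/ℚ) = Sel₂^{rel ∞}(W)`** — if moreover
`#Sel_𝔓(A_χ/ℚ) = 2·#Sel₂(W)`, the inclusion of part 1 is an equality of finite groups (`#Sel₂^{rel ∞} ≤ 2·#Sel₂`): the rigid twisted Selmer group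
IS the ∞-relaxed Selmer group of `W`, a description in which `d` does not occur. [cite: MazurRubin2010, Lemma 3.2 and Prop. 3.3] -/
theorem primeTwist_selmerGroup_eq_relaxed_of_inert (hd : DescAdmissible W d) (hχ : IsQuadraticCharacterOf χ d)
    (hinert : ∀ v : HeightOneSpectrum (𝓞 ℚ), ((2 : ℕ) : 𝓞 ℚ) ∉ v.asIdeal → W.HasGoodReductionAt v →
      (∀ s : v.adicCompletion ℚ, s ^ 2 ≠ algebraMap ℚ (v.adicCompletion ℚ) (d : ℚ)) →
      PrimeTwist.selmerLocalKer W χ (v.adicCompletion ℚ) ≤ W.selmerLocalKer (v.adicCompletion ℚ) 2)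
    (hcard : Nat.card (PrimeTwist.selmerGroup W χ) = 2 * selmerTwoCard W) :
    PrimeTwist.selmerGroup W χ = selmerGroupRelaxedAtInfinityAtTwo W := by
  have hle := primeTwist_selmerGroup_le_relaxed_of_inert W hd hχ hinert
  obtain ⟨hbound, hfin⟩ := natCard_selmerGroupRelaxedAtInfinityAtTwo_le_two_mul W
  haveI := hfin
  exact AddSubgroup.eq_of_le_of_card_ge hle (by rw [hcard]; exact hbound)

end Relaxed

/-! ## §127 DESC-§17-R `F1Sign2.TwistSelmerEqRelaxedAtInfinityAtTwo` BY NAME, modulo the inert comparison -/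

section ByName

/-- **DESC-§17-R HOLDS GIVEN THE INERT PRIME-TWIST COMPARISON.** Displayed hypothesis (no definition; the successor's brick): for every globally
minimal elliptic `W/ℚ`, every descent-admissible `d` with character `χ`, and every odd good place `v` without a local square root of `d`,
`PrimeTwist.selmerLocalKer W χ ℚ_v ≤ W.selmerLocalKer ℚ_v 2` (MR 2007 §5 / 2010 Lemma 2.10 (v): at a good prime unramified in `L/K` the twisted
local condition is the unramified one, as is `E`'s). Conclusion: the cell's row `TwistSelmerEqRelaxedAtInfinityAtTwo` verbatim.
[cite: MazurRubin2010, Def. 3.1, Lemma 3.2, Lemma 2.10] [cite: MazurRubin2007, Def 4.3, Cor 4.6, §5] -/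
theorem twistSelmerEqRelaxedAtInfinityAtTwo_of_inertComparison
    (hinert : ∀ (W : WeierstrassCurve ℚ) [W.IsElliptic] [W.IsGloballyMinimal] (d : ℤ)
      (χ : absoluteGaloisGroup ℚ →ₜ* Multiplicative (ZMod 2)), DescAdmissible W d → IsQuadraticCharacterOf χ d →
      ∀ v : HeightOneSpectrum (𝓞 ℚ), ((2 : ℕ) : 𝓞 ℚ) ∉ v.asIdeal → W.HasGoodReductionAt v →
        (∀ s : v.adicCompletion ℚ, s ^ 2 ≠ algebraMap ℚ (v.adicCompletion ℚ) (d : ℚ)) →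
        PrimeTwist.selmerLocalKer W χ (v.adicCompletion ℚ) ≤ W.selmerLocalKer (v.adicCompletion ℚ) 2) :
    TwistSelmerEqRelaxedAtInfinityAtTwo := by
  intro W _ _ d χ hd hχ
  exact ⟨primeTwist_selmerGroup_le_relaxed_of_inert W hd hχ (hinert W d χ hd hχ),
    primeTwist_selmerGroup_eq_relaxed_of_inert W hd hχ (hinert W d χ hd hχ)⟩

end ByName

end Summit.BirchSwinnertonDyer.BirchSwinnertonDyer.Theorems.GenusKolyArch

end
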